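import Summits.ABC.IUTFork.Cor312PilotIdelesPrInclusion
import Summits.ABC.IUTFork.Cor312VolumesPadicPerm
import Literature.IUT.LogVolume.TensorPacketStepV
import Literature.IUT.LogVolume.TensorPacketSlotTwists
import Literature.IUT.LogVolume.LogShellTopology
import Literature.IUT.LogVolume.LocalDegreeBridge
import HarnessLib

/-!
# [IUTchIII] Cor. 3.12 at the sharp genuine setting — LEMMAS for «`¬ Licence` at a degree-one bad place»
# (comparison-map naturality, slot-twisted boxes on constant tuples, Dupuy–Hilado (Ind2) at a degree-one place, the idele gap)

PROOF-ONLY record file (D-0012; 0 definitions, 0 `Prop` facts) of the abc-iut cell, WAVE-5 D-0068 discharge seat abc-iut-w5-d204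
(gen 6); companion (consumer): `Cor312LicenceSharpDegreeOne` (the theorem `¬ Thm311ToCor312.Licence (settingPrVolSharp …)` whenever some
bad place has local degree one — the C-lead's E3 test, plan ruling C-R12 (b)). TAKES NO SIDE on [IUTchIII] Cor. 3.12 or on any author;
every statement is about OUR typed objects (abc-iut-c312-5's `PadicPresentation` / `Real.logShellsDH`, abc-iut-c312-3's real tensor
packets `⊗_{ℚ_p} k_a` with `ι_i`, `(R_I)^∼ = normalizedPacket`, `ψ = dEquiv`, abc-iut-c312-7's `settingPrVolSharp` idele binders).

CONTENTS (standard axioms).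
* §1 `exists_eq_smul_of_finrank_eq_one` — a `ℚ_p`-linear automorphism of a one-dimensional `ℚ_p`-algebra is a scalar;
  `norm_eq_one_of_smul_logUnits_eq` — a scalar `c` with `c·log_p(𝒪_K^×) = log_p(𝒪_K^×)` is a unit (`log_p(𝒪_K^×)` compact, open, `∋ 0`:
  campaign-S `isCompact_logUnits`/`isOpen_logUnits`); `congr_apply_eq_prod_smul` — `⊗_a (c_a·) = (Π_a c_a)·` on `⊗_{ℚ_p} k_a`.
* §2 `comparison_permute`, `comparison_factorwise` — the naturality squares inside abc-iut-c312-5's `perm_preserves` /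
  `factorwise_preserves`, recorded as EQUATIONS (`e(permute σ·z)_{v⃗} = perm_σ(e(z)_{v⃗∘σ})`, `e(⊗⊕g·z)_{v⃗} = (⊗_a g'_{a,v⃗ a})(e(z)_{v⃗})`);
  `comparison_tprod_single_const` / `_of_ne` — the comparison of a pure tensor supported at ONE place `x₀` is the pure tensor of its values
  on the constant tuple `(x₀,…,x₀)` and `0` on every other tuple.
* §3 `mem_iota_smul_normalizedPacket_iff` (membership in `ι_i(a)·(R_I)^∼` = every `ψ`-component has norm `≤ ‖a‖`, abc-iut-c312-d1
  `image_iota_smul_normalizedPacket`), `smul_mem_iota_smul_normalizedPacket_iff` (unit scalars preserve it),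
  `image_permAlgEquiv_iota_smul_normalizedPacket_const` (on a CONSTANT tuple `perm_σ` fixes `ι_i(q)·(R_I)^∼`: abc-iut-c312-d1
  `image_permAlgEquiv_iota_smul_normalizedPacket` + `iota_smul_normalizedPacket_eq_of_norm_eq`, STEPV-IND1-NOTE §2 "void for constant
  collections").
* §4 `exists_unit_smul_of_ism_of_localDegree_eq_one` — **at a place `v | p` with `[F_v : ℚ_p] = 1` every Dupuy–Hilado (Ind2) element
  (`Real.ismDH`: bicontinuous, `ℚ`-linear, `g(I_v) = I_v`; §4.9 "`ℤ_p`-lattice isomorphisms of `I_v`") acts on `F_v` as a UNIT SCALAR of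
  `ℚ_p`** (abc-iut-S7 `RescaledCompletion.localDeg_eq_finrank`, abc-iut-c312-5 `PadicPresentation.image_logUnits_eq`);
  `norm_thetaIdele_lt_norm_qIdele_of_realises` — for realising ideles, `‖t_{Θ,i+1,v}‖ < ‖t_{q,v}‖` at a bad place `v ∈ S` and `i ≥ 1`
  (`P_q(v) = ord_v(q_v)/2l > 0`, abc-iut-w4-d036 `log_norm_thetaIdele_eq_of_realises`).
[claim: Mochizuki2012, status: disputed] for every quoted notion; [cite: DupuyHilado2025, §3.3–§3.4, §4.7, §4.9];
[cite: Mochizuki2012, IUTchIV Prop. 1.4 (i) p. 13] (field decomposition). typed ≠ proved; instantiated ≠ endorsed.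
-/

noncomputable section

open Set Function NumberField IsDedekindDomain
open scoped Pointwise

namespace Summit.ABC.IUTFork.Cor312Vol.LicenceSharpDegreeOne

open Thm311 Thm311.Real Cor312 Cor312.Setting Cor312Vol Literature.IUT.LogThetaLattice Literature.IUT.LogVolume
  Literature.NumberTheory.NumberFields
/-! ## §1. Three elementary lemmas -/

/-- A linear automorphism of a one-dimensional `ℚ_p`-algebra is a scalar. [folklore] -/
theorem exists_eq_smul_of_finrank_eq_one {p : ℕ} [Fact p.Prime] {K : Type} [Field K] [Algebra ℚ_[p] K]
    (h : Module.finrank ℚ_[p] K = 1) (g : K ≃ₗ[ℚ_[p]] K) : ∃ c : ℚ_[p], ∀ z, g z = c • z := by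
  have h1 := (finrank_eq_one_iff_of_nonzero' (1 : K) one_ne_zero).mp h
  obtain ⟨c, hc⟩ := h1 (g 1)
  refine ⟨c, fun z => ?_⟩
  obtain ⟨d, rfl⟩ := h1 z
  rw [map_smul, ← hc, smul_smul, smul_smul, mul_comm]

/-- A scalar `c ∈ ℚ_p` with `c·log_p(𝒪_K^×) = log_p(𝒪_K^×)` is a unit: `log_p(𝒪_K^×)` is compact, open and contains `0`.
[folklore] -/
theorem norm_eq_one_of_smul_logUnits_eq {p : ℕ} [Fact p.Prime] {K : Type} [NontriviallyNormedField K]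
    [NormedAlgebra ℚ_[p] K] [IsUltrametricDist K] [ProperSpace K] {c : ℚ_[p]}
    (h : c • logUnits K = logUnits K) : ‖c‖ = 1 := by
  obtain ⟨z₀, hz₀, hmax⟩ := (isCompact_logUnits p K).exists_isMaxOn ⟨0, zero_mem_logUnits (p := p)⟩
    continuous_norm.continuousOn
  obtain ⟨ε, hε, hball⟩ := Metric.isOpen_iff.mp (isOpen_logUnits p K) 0 (zero_mem_logUnits (p := p))
  obtain ⟨w, hw0, hwε⟩ := NormedField.exists_norm_lt K hε
  have hw : w ∈ logUnits K := hball (by rwa [Metric.mem_ball, dist_zero_right])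
  have hz₀pos : 0 < ‖z₀‖ := hw0.trans_le (hmax hw)
  have hle : ‖c‖ ≤ 1 := by
    have hcz : c • z₀ ∈ logUnits K := by rw [← h]; exact Set.smul_mem_smul_set hz₀
    have h1 : ‖c • z₀‖ ≤ ‖z₀‖ := hmax hcz
    rw [norm_smul] at h1
    exact (mul_le_iff_le_one_left hz₀pos).mp h1
  have hge : 1 ≤ ‖c‖ := by
    have hz₀' : z₀ ∈ c • logUnits K := by rw [h]; exact hz₀
    obtain ⟨z₁, hz₁, rfl⟩ := Set.mem_smul_set.mp hz₀'
    have h1 : ‖z₁‖ ≤ ‖c • z₁‖ := hmax hz₁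
    rw [norm_smul] at h1 hz₀pos
    have hz₁pos : 0 < ‖z₁‖ := by
      rcases (norm_nonneg z₁).lt_or_eq with h | h
      · exact h
      · rw [← h, mul_zero] at hz₀pos; exact absurd hz₀pos (lt_irrefl _)
    nlinarith
  exact le_antisymm hle hge

/-- On a real tensor packet `⊗_{ℚ_p} k_a`, the factorwise automorphism `⊗_a g_a` with every `g_a` a scalar `c_a` is the scalar
`Π_a c_a`. [folklore] -/
theorem congr_apply_eq_prod_smul {p : ℕ} [Fact p.Prime] {I : Type} [Fintype I] [DecidableEq I] {k : I → Type}
    [∀ a, NontriviallyNormedField (k a)] [∀ a, NormedAlgebra ℚ_[p] (k a)]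
    (g : ∀ a, k a ≃ₗ[ℚ_[p]] k a) (c : I → ℚ_[p]) (hg : ∀ a z, g a z = c a • z) (x : PacketAlgebra p k) :
    PiTensorProduct.congr g x = (∏ a, c a) • x := by
  have key : (PiTensorProduct.congr g : PacketAlgebra p k ≃ₗ[ℚ_[p]] PacketAlgebra p k).toLinearMap =
      (∏ a, c a) • LinearMap.id := by
    refine PiTensorProduct.ext (MultilinearMap.ext fun y => ?_)
    simp only [LinearMap.compMultilinearMap_apply, LinearEquiv.coe_coe, PiTensorProduct.congr_tprod,
      LinearMap.smul_apply, LinearMap.id_coe, id_eq]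
    rw [show (fun a => g a (y a)) = fun a => c a • y a from funext fun a => hg a (y a)]
    exact (PiTensorProduct.tprod ℚ_[p]).map_smul_univ c y
  exact LinearMap.congr_fun key x


/-! ## §2. The comparison map against the generators, and a pure tensor supported at one place -/

section Presentation

open PiTensorProduct

variable {T : ThetaIndex} {L : LogShells T} {vQ : T.VQ} {p : ℕ} [Fact p.Prime] (P : PadicPresentation L vQ p)
  {j : T.Label}

/-- **(Ind1) through the comparison**: `e(permute σ · z)_{v⃗} = perm_σ (e(z)_{v⃗∘σ})` (the naturality inside abc-iut-c312-5's
`PadicPresentation.perm_preserves`, recorded as an equation). [cite: DupuyHilado2025, §4.7] -/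
theorem comparison_permute (σ : Equiv.Perm (T.Caps j)) (z : L.Packet j vQ) (e : T.Caps j → T.Fibre vQ) :
    P.comparison j (L.permute j vQ σ z) e = P.permX σ e (P.comparison j z (e ∘ σ)) := by
  have key : (LinearMap.proj e ∘ₗ P.comparison j) ∘ₗ (L.permute j vQ σ).toLinearMap =
      ((P.permX σ e).toLinearMap.restrictScalars ℚ) ∘ₗ (LinearMap.proj (e ∘ σ) ∘ₗ P.comparison j) := by
    refine PiTensorProduct.ext (MultilinearMap.ext fun y => ?_)
    simp only [LinearMap.compMultilinearMap_apply]
    change P.comparison j (L.permute j vQ σ (L.tprod j vQ y)) e = P.permX σ e (P.comparison j (tprod ℚ y) (e ∘ σ))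
    rw [L.permute_tprod]
    change P.comparison j (tprod ℚ fun i => y (σ.symm i)) e = _
    rw [P.comparison_tprod, P.comparison_tprod]
    change _ = P.permX σ e (tprod ℚ_[p] fun a => (P.φ (e (σ a))) (y a (e (σ a))))
    rw [PadicPresentation.permX_apply]
    refine Eq.trans (congrArg _ (funext fun b => ?_))
      (permLinearEquiv_tprod p (P.kk e) σ fun a => P.φ (e (σ a)) (y a (e (σ a)))).symm
    obtain ⟨a, rfl⟩ := σ.surjective b
    rw [Equiv.piCongrLeft_apply_apply, Equiv.symm_apply_apply]
  exact LinearMap.congr_fun key z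

/-- **(Ind2) through the comparison**: a factor-and-summand-wise family `⊗_i ⊕_v g_{i,v}` intertwined through `φ` with `ℚ_p`-linear
`g'_{i,v}` acts on the summand `X_{v⃗}` by `⊗_{a,ℚ_p} g'_{a,v⃗(a)}` (the naturality inside abc-iut-c312-5's `factorwise_preserves`,
recorded as an equation). [cite: DupuyHilado2025, §4.9] -/
theorem comparison_factorwise (g : T.Caps j → ∀ v : T.Fibre vQ, L.carrier v.1 ≃ₗ[ℚ] L.carrier v.1)
    (g' : T.Caps j → ∀ v : T.Fibre vQ, P.k v ≃ₗ[ℚ_[p]] P.k v) (hg' : ∀ i v x, P.φ v (g i v x) = g' i v (P.φ v x))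
    (z : L.Packet j vQ) (e : T.Caps j → T.Fibre vQ) :
    P.comparison j (L.factorwise j vQ (fun i => L.summandwise vQ (g i)) z) e =
      PiTensorProduct.congr (fun a => g' a (e a)) (P.comparison j z e) := by
  have key : (LinearMap.proj e ∘ₗ P.comparison j) ∘ₗ (L.factorwise j vQ (fun i => L.summandwise vQ (g i))).toLinearMap =
      ((PiTensorProduct.congr (fun a => g' a (e a)) : P.X e ≃ₗ[ℚ_[p]] P.X e).toLinearMap.restrictScalars ℚ) ∘ₗ
        (LinearMap.proj e ∘ₗ P.comparison j) := by
    refine PiTensorProduct.ext (MultilinearMap.ext fun y => ?_)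
    simp only [LinearMap.compMultilinearMap_apply]
    change P.comparison j (L.factorwise j vQ (fun i => L.summandwise vQ (g i)) (L.tprod j vQ y)) e =
      PiTensorProduct.congr (fun a => g' a (e a)) (P.comparison j (tprod ℚ y) e)
    rw [L.factorwise_summandwise_tprod]
    change P.comparison j (tprod ℚ fun i => fun v => g i v (y i v)) e = _
    rw [P.comparison_tprod, P.comparison_tprod]
    simp only [PiTensorProduct.congr_tprod]
    exact congrArg _ (funext fun a => hg' a (e a) (y a (e a)))
  exact LinearMap.congr_fun key z

/-- The comparison of a pure tensor SUPPORTED AT ONE PLACE `x₀`, at the constant tuple `(x₀, …, x₀)`: the pure tensor of the values.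
[folklore] -/
theorem comparison_tprod_single_const [DecidableEq (T.Fibre vQ)] (x₀ : T.Fibre vQ) (w : T.Caps j → L.carrier x₀.1) :
    P.comparison j (L.tprod j vQ fun a => Pi.single (M := fun v : T.Fibre vQ => L.carrier v.1) x₀ (w a)) (fun _ => x₀) =
      tprod ℚ_[p] fun a => P.φ x₀ (w a) := by
  change P.comparison j (tprod ℚ fun a => Pi.single (M := fun v : T.Fibre vQ => L.carrier v.1) x₀ (w a)) (fun _ => x₀) = _
  rw [P.comparison_tprod]
  exact congrArg _ (funext fun a => by rw [Pi.single_eq_same])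

/-- … and at any other tuple it VANISHES (some factor sits at a place `≠ x₀`, where the vector is `0`). [folklore] -/
theorem comparison_tprod_single_of_ne [DecidableEq (T.Fibre vQ)] (x₀ : T.Fibre vQ) (w : T.Caps j → L.carrier x₀.1)
    {e : T.Caps j → T.Fibre vQ} {a₀ : T.Caps j} (ha₀ : e a₀ ≠ x₀) :
    P.comparison j (L.tprod j vQ fun a => Pi.single (M := fun v : T.Fibre vQ => L.carrier v.1) x₀ (w a)) e = 0 := by
  change P.comparison j (tprod ℚ fun a => Pi.single (M := fun v : T.Fibre vQ => L.carrier v.1) x₀ (w a)) e = _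
  rw [P.comparison_tprod]
  refine MultilinearMap.map_coord_zero (tprod ℚ_[p]) a₀ ?_
  show P.φ (e a₀) (Pi.single (M := fun v : T.Fibre vQ => L.carrier v.1) x₀ (w a₀) (e a₀)) = 0
  rw [Pi.single_eq_of_ne ha₀, map_zero]

end Presentation


/-! ## §3. Two facts on a real tensor packet: membership in a slot-twisted box, and its (Ind1)-stability on a constant tuple -/

section Packet

variable (p : ℕ) [Fact p.Prime] {I : Type} [Fintype I] [DecidableEq I] [Nonempty I]
  (k : I → Type) [∀ a, NontriviallyNormedField (k a)] [∀ a, NormedAlgebra ℚ_[p] (k a)]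
  [∀ a, IsUltrametricDist (k a)] [∀ a, ProperSpace (k a)]

/-- Membership in the slot-twisted box `ι_i(a)·(R_I)^∼` is read on abc-iut-c312-3's field decomposition `ψ`: every component has norm
`≤ ‖a‖` (`ψ(ι_i(a)·(R_I)^∼)` is the polydisc of constant radius `‖a‖`, abc-iut-c312-d1 `image_iota_smul_normalizedPacket`).
[cite: Mochizuki2012, IUTchIV Prop. 1.4 (i) p. 13] -/
theorem mem_iota_smul_normalizedPacket_iff (i : I) {a : k i} (ha : a ≠ 0) (z : PacketAlgebra p k) :
    z ∈ iota p k i a • (normalizedPacket p k : Set (PacketAlgebra p k)) ↔ ∀ j, ‖dEquiv p k z j‖ ≤ ‖a‖ := by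
  rw [← (dEquiv p k).injective.mem_set_image, image_iota_smul_normalizedPacket p k (DFac p k) (dEquiv p k) i ha, mem_polydisc]

/-- Unit scalars of `ℚ_p` preserve every slot-twisted box. [folklore] -/
theorem smul_mem_iota_smul_normalizedPacket_iff (i : I) {a : k i} (ha : a ≠ 0) {c : ℚ_[p]} (hc : ‖c‖ = 1)
    (z : PacketAlgebra p k) :
    c • z ∈ iota p k i a • (normalizedPacket p k : Set (PacketAlgebra p k)) ↔
      z ∈ iota p k i a • (normalizedPacket p k : Set (PacketAlgebra p k)) := by
  rw [mem_iota_smul_normalizedPacket_iff p k i ha, mem_iota_smul_normalizedPacket_iff p k i ha]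
  refine forall_congr' fun j => ?_
  rw [map_smul, Pi.smul_apply, norm_smul, hc, one_mul]

/-- **On a CONSTANT tuple the capsule permutations fix the sharp box**: for the constant family of fields `a ↦ K₀`, the factor
permutation `perm_σ` carries `ι_i(q)·(R_I)^∼` to `ι_{σ(i)}(q)·(R_I)^∼` (abc-iut-c312-d1 `image_permAlgEquiv_iota_smul_normalizedPacket`),
which IS `ι_i(q)·(R_I)^∼` (same element, same norm at both slots: `iota_smul_normalizedPacket_eq_of_norm_eq`, STEPV-IND1-NOTE §2 "void
for constant collections"). [cite: Mochizuki2012, IUTchIV Thm. 1.10 proof Step (v) pp. 27–28] -/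
theorem image_permAlgEquiv_iota_smul_normalizedPacket_const {K₀ : Type} [NontriviallyNormedField K₀] [NormedAlgebra ℚ_[p] K₀]
    [IsUltrametricDist K₀] [ProperSpace K₀] (σ : Equiv.Perm I) (i : I) {q : K₀} (hq : q ≠ 0) :
    permAlgEquiv p (fun _ : I => K₀) σ ''
        (iota p (fun _ : I => K₀) i q • (normalizedPacket p (fun _ : I => K₀) : Set (PacketAlgebra p fun _ : I => K₀))) =
      iota p (fun _ : I => K₀) i q • (normalizedPacket p (fun _ : I => K₀) : Set (PacketAlgebra p fun _ : I => K₀)) := by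
  have h := image_permAlgEquiv_iota_smul_normalizedPacket p (fun _ : I => K₀) σ i q
  refine h.trans ?_
  exact iota_smul_normalizedPacket_eq_of_norm_eq p (fun _ : I => K₀) (DFac p fun _ : I => K₀) (dEquiv p fun _ : I => K₀)
    (σ i) i hq rfl

end Packet

/-! ## §4. The setting: `¬ Licence (settingPrVolSharp …)` at a degree-one bad place -/

section Setting

variable {F : Type} [Field F] [NumberField F] (X : PilotData F) {logv : PadicLogs F} (hlog : LogvAnalytic logv)

/-- **DEGREE-ONE PLACES: the Dupuy–Hilado (Ind2) group acts by UNIT SCALARS.** At a place `v | p` with `[F_v : ℚ_p] = 1`, an element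
`g ∈ Ism_v` of abc-iut-c312-5's DH signature (`Real.ismDH`: bicontinuous, `ℚ`-linear, `g(I_v) = I_v`; Dupuy–Hilado §4.9
"`ℤ_p`-lattice isomorphisms of `I_v`"), read in the rescaled completion through the presentation (`ℚ_p`-linear `g'`), is multiplication
by a scalar `c ∈ ℚ_p` with `|c|_p = 1`: `K_v = ℚ_p·1`, so `g' = c·(−)`, and `c·log_p(𝒪_v^×) = log_p(𝒪_v^×)` forces `|c| = 1`.
[cite: DupuyHilado2025, §4.9] -/
theorem exists_unit_smul_of_ism_of_localDegree_eq_one (pp : Nat.Primes) (x₀ : (thetaIndex X).Fibre (.inr pp))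
    (hdeg : haveI : Fact (pp : ℕ).Prime := ⟨pp.2⟩; localDegree F (placeOf X pp.1 x₀) = 1)
    {g : (logShellsDH X logv).carrier x₀.1 ≃ₗ[ℚ] (logShellsDH X logv).carrier x₀.1}
    (hg : g ∈ (logShellsDH X logv).ism x₀.1)
    (g' : haveI : Fact (pp : ℕ).Prime := ⟨pp.2⟩; (presAt X hlog pp).k x₀ ≃ₗ[ℚ_[pp]] (presAt X hlog pp).k x₀)
    (hg' : haveI : Fact (pp : ℕ).Prime := ⟨pp.2⟩; ∀ x, (presAt X hlog pp).φ x₀ (g x) = g' ((presAt X hlog pp).φ x₀ x)) :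
    haveI : Fact (pp : ℕ).Prime := ⟨pp.2⟩; ∃ c : ℚ_[pp], ‖c‖ = 1 ∧ ∀ z, g' z = c • z := by
  haveI : Fact (pp : ℕ).Prime := ⟨pp.2⟩
  have hlogU := (presAt X hlog pp).image_logUnits_eq hg' ((presAt X hlog pp).ism_shell x₀ g hg)
  have hfin : Module.finrank ℚ_[pp] ((presAt X hlog pp).k x₀) = 1 := by
    have h := RescaledCompletion.localDeg_eq_finrank F pp.1 (placeOf X pp.1 x₀) (natCast_mem_placeOf X pp.1 x₀)
    rw [localDeg_eq_localDegree, hdeg] at h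
    exact h.symm
  obtain ⟨c, hc⟩ := exists_eq_smul_of_finrank_eq_one hfin g'
  refine ⟨c, norm_eq_one_of_smul_logUnits_eq (p := pp.1) (K := (presAt X hlog pp).k x₀) ?_, hc⟩
  have hcg : c • logUnits ((presAt X hlog pp).k x₀) = g' '' logUnits ((presAt X hlog pp).k x₀) := by
    rw [← Set.image_smul]
    exact Set.image_congr fun z _ => (hc z).symm
  rw [hcg, hlogU]

variable (M : Type) [Field M] [NumberField M]
  (archPk : ∀ (j : (thetaIndex X).Label) (vQ : (thetaIndex X).VQ), Set ((logShellsDH X logv).Packet j vQ))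
  (archSub : ∀ (j : (thetaIndex X).Label) (v : (thetaIndex X).V),
    Set ((logShellsDH X logv).Packet j ((thetaIndex X).over v)))
  (Ψ : ℤ → ∀ v : (thetaIndex X).V, v ∈ (thetaIndex X).Vbad → Set ((logShellsDH X logv).StarPacket v))
  (act : ℤ → ∀ v : (thetaIndex X).V, v ∈ (thetaIndex X).Vbad →
    (logShellsDH X logv).StarPacket v → Module.End ℚ ((logShellsDH X logv).StarPacket v))
  (Mmod : ℤ → ∀ j : (thetaIndex X).LabelStar, Set ((logShellsDH X logv).GlobalPacket j.1))
  (region : ℤ → ∀ j : (thetaIndex X).LabelStar, FinDivisor M → ∀ vQ : (thetaIndex X).VQ,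
    Set ((logShellsDH X logv).Packet j.1 vQ))
  (n : ℤ) {HT : Type} {LogLink : HT → HT → Type} {IsFull : ∀ {s t : HT}, LogLink s t → Prop}
  (lat : LGPGaussianLogThetaLattice LogLink IsFull)
  {Frd : Type} {IsoF : Frd → Frd → Type} {Ob : Frd → Type} {realify : Frd → Frd} {Strip : Type}
  {IsoS : Strip → Strip → Type} {Mv : ∀ v : (thetaIndex X).V, v ∈ (thetaIndex X).Vbad → Type}
  [∀ v h, Monoid (Mv v h)]
  (sig : GlobalLGPFrobenioidSignature (thetaIndex X).lstar (thetaIndex X).V (· ∈ (thetaIndex X).Vbad)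
    Frd IsoF Ob realify Strip IsoS Mv)
  (split : SplittingMonoids Mv) {ObΔ : Type} {N : ∀ v : (thetaIndex X).V, v ∈ (thetaIndex X).Vbad → Type}
  [∀ v h, Monoid (N v h)] (qData : QPilotData ObΔ N)
  (t : ∀ (pp : Nat.Primes) (_ : Fin X.lstar) (x : (thetaIndex X).Fibre (.inr pp)),
    haveI : Fact (pp : ℕ).Prime := ⟨pp.2⟩; kOf X pp.1 x)
  (ht0 : ∀ pp i x, t pp i x ≠ 0)
  /- the Θ-ideles REALISE `P_Θ` in Dupuy–Hilado's normalisation (3.4) -/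
  (ht : ∀ (pp : Nat.Primes) (i : Fin X.lstar) (x : (thetaIndex X).Fibre (.inr pp)),
    haveI : Fact (pp : ℕ).Prime := ⟨pp.2⟩
    Real.log ‖t pp i x‖ = -(X.thetaPilot i (placeOf X pp.1 x)) * logNorm F (placeOf X pp.1 x) /
      localDegree F (placeOf X pp.1 x))
  (tq : ∀ (pp : Nat.Primes) (x : (thetaIndex X).Fibre (.inr pp)), haveI : Fact (pp : ℕ).Prime := ⟨pp.2⟩; kOf X pp.1 x)
  (htq0 : ∀ pp x, tq pp x ≠ 0)
  (htq1 : ∀ (pp : Nat.Primes) (x : (thetaIndex X).Fibre (.inr pp)),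
    haveI : Fact (pp : ℕ).Prime := ⟨pp.2⟩; placeOf X pp.1 x ∉ X.S → ‖tq pp x‖ = 1)
  /- the `q`-ideles REALISE `P_q` -/
  (htq : ∀ (pp : Nat.Primes) (x : (thetaIndex X).Fibre (.inr pp)),
    haveI : Fact (pp : ℕ).Prime := ⟨pp.2⟩
    Real.log ‖tq pp x‖ = -(X.qPilot (placeOf X pp.1 x)) * logNorm F (placeOf X pp.1 x) /
      localDegree F (placeOf X pp.1 x))

include ht0 ht htq0 htq in
/-- For realising ideles, at a BAD place `v ∈ S` and a label `j = i+1 ≥ 2` the Θ-idele is STRICTLY smaller than the `q`-idele: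
`‖t_{Θ,j,v}‖ = ‖t_{q,v}‖^{j²} < ‖t_{q,v}‖` (`P_q(v) = ord_v(q_v)/2l > 0`, `j² > 1`). [cite: DupuyHilado2025, §3.3, §3.4] -/
theorem norm_thetaIdele_lt_norm_qIdele_of_realises (pp : Nat.Primes) (i : Fin X.lstar) (hi : 1 ≤ (i : ℕ))
    (x : (thetaIndex X).Fibre (.inr pp)) (hx : haveI : Fact (pp : ℕ).Prime := ⟨pp.2⟩; placeOf X pp.1 x ∈ X.S) :
    haveI : Fact (pp : ℕ).Prime := ⟨pp.2⟩; ‖t pp i x‖ < ‖tq pp x‖ := by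
  haveI : Fact (pp : ℕ).Prime := ⟨pp.2⟩
  have hq0 : 0 < ‖tq pp x‖ := norm_pos_iff.mpr (htq0 pp x)
  have ht0' : 0 < ‖t pp i x‖ := norm_pos_iff.mpr (ht0 pp i x)
  rw [← Real.log_lt_log_iff ht0' hq0, log_norm_thetaIdele_eq_of_realises X t ht tq htq pp i x]
  have hlog : Real.log ‖tq pp x‖ < 0 := by
    rw [htq pp x, X.qPilot_apply_of_mem hx]
    have h1 : (0 : ℝ) < X.ordq (placeOf X pp.1 x) := by exact_mod_cast X.ordq_pos hx
    have h2 : 0 < logNorm F (placeOf X pp.1 x) := logNorm_pos F _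
    have h3 : (0 : ℝ) < localDegree F (placeOf X pp.1 x) := by exact_mod_cast localDegree_pos F _
    have h4 : (0 : ℝ) < X.ordq (placeOf X pp.1 x) / (2 * X.l) := div_pos h1 X.two_mul_l_pos
    have : 0 < X.ordq (placeOf X pp.1 x) / (2 * X.l) * logNorm F (placeOf X pp.1 x) / localDegree F (placeOf X pp.1 x) :=
      div_pos (mul_pos h4 h2) h3
    rw [neg_mul, neg_div]
    linarith
  have hsq : (1 : ℝ) < ((i : ℕ) + 1 : ℝ) ^ 2 := by
    have : (2 : ℝ) ≤ (i : ℕ) + 1 := by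
      have : (1 : ℝ) ≤ (i : ℕ) := by exact_mod_cast hi
      linarith
    nlinarith
  nlinarith

end Setting

end Summit.ABC.IUTFork.Cor312Vol.LicenceSharpDegreeOne

end
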